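import Summits.HubbardSuperconductivity.HubbardSuperconductivity.Theorems.KacWindowPenaltyWindowGapNormalForms

/-!
# Route `KacWindowPenalty` — crux `WindowGap` (stmt-HubbardSuperconductivity-1088): window nesting

Supports for the crux, line `Sketch` (idea `parabolic-descent`). The Kac-window pair penalty
`W_ε = L⁻² Σ_{|q_m| ≤ ε} Δ_d(m)ᴴ Δ_d(m)` is MONOTONE in the window radius as a quadratic form:
for `ε'² ≤ ε²` every label passing the small window passes the large one and each summand is a
pair structure factor `≥ 0`, so `Re⟨ψ, W_{ε'} ψ⟩ ≤ Re⟨ψ, W_ε ψ⟩` (`re_dotProduct_kacWindow_mulVec_mono`),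
hence `minE(H + λW_{ε'} | K) ≤ minE(H + λW_ε | K)` for `λ ≥ 0` (`minEnergyOn_add_smul_kacWindow_mono`)
and a BASE inequality `λ⋆A⋆L² ≤ minE(H_L + λ⋆W_{ε⋆} | K_L) − minE(H_L | K_L)` at scale `ε⋆` implies the
same inequality at every larger scale `ε` with the SAME `(λ⋆, A⋆)` (`windowBase_mono`): the base of
the parabolic descent is weakest at the full window, where `W_ε` is the local pair repulsion
`Σ_x P_xᴴ P_x` (`stub_fullWindow`). Equivalently, the dyadic-annulus weights `Re⟨ψ,(W_{ε_k} −
W_{ε_{k+1}})ψ⟩` charged by the descent are nonnegative. No definitions, no named facts, no physics.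
Source: H. Tasaki, *Physics and Mathematics of Quantum Many-Body Systems* (2020) §2.1 (variational
principle / comparison of quadratic forms).
-/

-- the mandated namespace `Summit.<Summit>.<Problem>.Theorems` repeats `HubbardSuperconductivity`
-- (single-problem summit, D-0017), which the `dupNamespace` linter flags on every declaration
set_option linter.dupNamespace false

namespace Summit.HubbardSuperconductivity.HubbardSuperconductivity.Theorems

open Matrix Literature.MathematicalPhysics.QuantumLattice
open scoped ComplexOrder

/-- **Window nesting, quadratic-form version**: for `ε'² ≤ ε²` and every Fock vector `ψ`,
`Re⟨ψ, W_{ε'} ψ⟩ ≤ Re⟨ψ, W_ε ψ⟩` (termwise: a label in the small window is in the large one, and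
every summand `‖Δ_d(m)ψ‖²/L² ≥ 0`). Tasaki (2020) §2.1. [folklore] -/
theorem re_dotProduct_kacWindow_mulVec_mono (L : ℕ) [NeZero L] {ε ε' : ℝ} (hε : ε' ^ 2 ≤ ε ^ 2)
    (ψ : Fock (Orb (FermionTorus 2 L))) :
    (star ψ ⬝ᵥ (∑ m : Fin 2 → ZMod L,
        if (2 * Real.pi / (L : ℝ)) ^ 2 * (∑ i : Fin 2, (((m i).valMinAbs : ℤ) : ℝ) ^ 2) ≤ ε' ^ 2 then
          ((L : ℂ) ^ 2)⁻¹ •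
            (Matrix.conjTranspose (pairFieldAt dWaveFormFactor L m) * pairFieldAt dWaveFormFactor L m)
        else 0) *ᵥ ψ).re ≤
      (star ψ ⬝ᵥ (∑ m : Fin 2 → ZMod L,
        if (2 * Real.pi / (L : ℝ)) ^ 2 * (∑ i : Fin 2, (((m i).valMinAbs : ℤ) : ℝ) ^ 2) ≤ ε ^ 2 then
          ((L : ℂ) ^ 2)⁻¹ •
            (Matrix.conjTranspose (pairFieldAt dWaveFormFactor L m) * pairFieldAt dWaveFormFactor L m)
        else 0) *ᵥ ψ).re := by
  rw [re_dotProduct_kacWindow_mulVec, re_dotProduct_kacWindow_mulVec]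
  refine Finset.sum_le_sum fun m _ => ?_
  have hnn : 0 ≤ (star (Matrix.mulVec (pairFieldAt dWaveFormFactor L m) ψ) ⬝ᵥ
      Matrix.mulVec (pairFieldAt dWaveFormFactor L m) ψ).re / (L : ℝ) ^ 2 :=
    div_nonneg (Complex.nonneg_iff.1 (dotProduct_star_self_nonneg _)).1 (sq_nonneg _)
  by_cases h' : (2 * Real.pi / (L : ℝ)) ^ 2 * (∑ i : Fin 2, (((m i).valMinAbs : ℤ) : ℝ) ^ 2) ≤ ε' ^ 2
  · rw [if_pos h', if_pos (h'.trans hε)]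
  · rw [if_neg h']
    split_ifs
    · exact hnn
    · exact le_rfl

/-- **Window nesting, energy version**: for `λ ≥ 0`, `ε'² ≤ ε²`, any matrix `H` and any subspace
`K` containing a unit vector, `minE(H + λW_{ε'} | K) ≤ minE(H + λW_ε | K)` (comparison of the
Rayleigh quotients termwise, `re_dotProduct_kacWindow_mulVec_mono`). Tasaki (2020) §2.1. [folklore] -/
theorem minEnergyOn_add_smul_kacWindow_mono (L : ℕ) [NeZero L] {ε ε' lam : ℝ} (hε : ε' ^ 2 ≤ ε ^ 2)
    (hlam : 0 ≤ lam) (H : Matrix (Finset (Orb (FermionTorus 2 L))) (Finset (Orb (FermionTorus 2 L))) ℂ)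
    (K : Submodule ℂ (Fock (Orb (FermionTorus 2 L)))) (hK : ∃ φ ∈ K, star φ ⬝ᵥ φ = 1) :
    (H + (lam : ℂ) • ∑ m : Fin 2 → ZMod L,
        if (2 * Real.pi / (L : ℝ)) ^ 2 * (∑ i : Fin 2, (((m i).valMinAbs : ℤ) : ℝ) ^ 2) ≤ ε' ^ 2 then
          ((L : ℂ) ^ 2)⁻¹ •
            (Matrix.conjTranspose (pairFieldAt dWaveFormFactor L m) * pairFieldAt dWaveFormFactor L m)
        else 0).minEnergyOn K ≤
      (H + (lam : ℂ) • ∑ m : Fin 2 → ZMod L,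
        if (2 * Real.pi / (L : ℝ)) ^ 2 * (∑ i : Fin 2, (((m i).valMinAbs : ℤ) : ℝ) ^ 2) ≤ ε ^ 2 then
          ((L : ℂ) ^ 2)⁻¹ •
            (Matrix.conjTranspose (pairFieldAt dWaveFormFactor L m) * pairFieldAt dWaveFormFactor L m)
        else 0).minEnergyOn K := by
  obtain ⟨φ₀, hφ₀K, hφ₀⟩ := hK
  change _ ≤ sInf _
  refine le_csInf ⟨_, φ₀, hφ₀K, hφ₀, rfl⟩ ?_
  rintro b ⟨ψ, hψK, hψ, rfl⟩
  refine (minEnergyOn_le_re_rayleigh _ K hψK hψ).trans ?_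
  rw [add_mulVec, dotProduct_add, Complex.add_re, smul_mulVec, dotProduct_smul, smul_eq_mul,
    Complex.re_ofReal_mul, add_mulVec, dotProduct_add, Complex.add_re, smul_mulVec, dotProduct_smul,
    smul_eq_mul, Complex.re_ofReal_mul]
  have h := re_dotProduct_kacWindow_mulVec_mono L hε ψ
  nlinarith [mul_le_mul_of_nonneg_left h hlam]

/-- **The base of the parabolic descent is weakest at the largest window.** If at `(U, δ)` the base
inequality `λ⋆A⋆L² ≤ minE(H_L + λ⋆W_{ε⋆} | K_L) − minE(H_L | K_L)` holds for all large even `L` at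
window radius `ε⋆`, with `λ⋆ ≥ 0`, then it holds verbatim at every radius `ε` with `ε⋆² ≤ ε²` — in
particular at a full window `ε² ≥ 2π²`, where `W_ε = Σ_x P_xᴴ P_x` (`stub_fullWindow`)
(`minEnergyOn_add_smul_kacWindow_mono`; the sector `szSector N_L 0` contains a unit vector by
`exists_unit_groundStateInSector_hubbardTorus`). Tasaki (2020) §2.1. [folklore] -/
theorem windowBase_mono {U δ εs ε lams As : ℝ} (hδ : δ ∈ Set.Ioo (0 : ℝ) (1 / 2))
    (hlam : 0 ≤ lams) (hε : εs ^ 2 ≤ ε ^ 2)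
    (hbase : ∃ L₀ : ℕ, ∀ (L : ℕ) [NeZero L], L₀ ≤ L → Even L →
      lams * As * (L : ℝ) ^ 2 ≤
        (hubbardTorus 2 L 1 U + (lams : ℂ) • ∑ m : Fin 2 → ZMod L,
            if (2 * Real.pi / (L : ℝ)) ^ 2 * (∑ i : Fin 2, (((m i).valMinAbs : ℤ) : ℝ) ^ 2) ≤ εs ^ 2
            then ((L : ℂ) ^ 2)⁻¹ • (Matrix.conjTranspose (pairFieldAt dWaveFormFactor L m) *
              pairFieldAt dWaveFormFactor L m)
            else 0).minEnergyOn (szSector (2 * ⌊(1 - δ) * (L : ℝ) ^ 2 / 2⌋₊) 0) -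
          (hubbardTorus 2 L 1 U).minEnergyOn (szSector (2 * ⌊(1 - δ) * (L : ℝ) ^ 2 / 2⌋₊) 0)) :
    ∃ L₀ : ℕ, ∀ (L : ℕ) [NeZero L], L₀ ≤ L → Even L →
      lams * As * (L : ℝ) ^ 2 ≤
        (hubbardTorus 2 L 1 U + (lams : ℂ) • ∑ m : Fin 2 → ZMod L,
            if (2 * Real.pi / (L : ℝ)) ^ 2 * (∑ i : Fin 2, (((m i).valMinAbs : ℤ) : ℝ) ^ 2) ≤ ε ^ 2
            then ((L : ℂ) ^ 2)⁻¹ • (Matrix.conjTranspose (pairFieldAt dWaveFormFactor L m) *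
              pairFieldAt dWaveFormFactor L m)
            else 0).minEnergyOn (szSector (2 * ⌊(1 - δ) * (L : ℝ) ^ 2 / 2⌋₊) 0) -
          (hubbardTorus 2 L 1 U).minEnergyOn (szSector (2 * ⌊(1 - δ) * (L : ℝ) ^ 2 / 2⌋₊) 0) := by
  obtain ⟨L₀, hL⟩ := hbase
  refine ⟨L₀, fun L _ hL₀ hE => (hL L hL₀ hE).trans ?_⟩
  obtain ⟨ψ₀, hψ₀, hgs⟩ :=
    Summit.HubbardSuperconductivity.NoGo.exists_unit_groundStateInSector_hubbardTorus L 1 U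
      (Summit.HubbardSuperconductivity.NoGo.floor_pairNumber_le δ (by linarith [hδ.1]) L)
  have hmono := minEnergyOn_add_smul_kacWindow_mono L hε hlam (hubbardTorus 2 L 1 U)
    (szSector (2 * ⌊(1 - δ) * (L : ℝ) ^ 2 / 2⌋₊) 0) ⟨ψ₀, hgs.1, hψ₀⟩
  linarith

end Summit.HubbardSuperconductivity.HubbardSuperconductivity.Theorems
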